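import Summits.QuantumFields.YangMills.Theorems.BalabanUVNodesN08HaarCompatibilityGuard

/-!
# BalabanUVNodes ∕ N08 — THE TYPED (0.4) AVERAGING IS THE AXIAL AVERAGING AFTER A REPARAMETRISATION OF THE CENTRAL CROSSING BONDS ALONE:
# `Ū = axial ∘ Ψ`, `(Ψ U)(β(c)) = pre⁻¹ · corr(U,c) · pre · U(β(c))`, `Ψ U = U` elsewhere; hence the TYPED E6′ letter `Ū_*(dU) = dV` FOLLOWS from
# `Ψ_*(dU) = dU`, and `Ψ` is triangular in the private coordinates `β` (its `β(c)`-output sees no other `β(c′)`)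

WIDTH SEAT `pub-ymgap-dag-n08-w3` g2, plan `W-SEAT-START-LIST.md` v7 §n08 item 3 PART 8 (structural sequel of part 6 p594625 `…N08HaarCompatibilityGuard`),
2026-08-28.  Track A, DAG node N08 = [Balaban1985UV3] Thm 1 p. 257 (compact) + Thm 2 p. 272; key item K1⁷ `StabilityBAtRecordR13SepCoPH`
(stmt-QuantumFields-20542), `--supports … --as helper`.  COUNT-NEUTRAL.

THE POINT.  Part 6 localised the typed E6′ letter to the small-field guard; here the typed averaging itself is put in NORMAL FORM over the axial one.
By `BlockAveragingHaarAC` ([Balaban1987RG1] (0.4) p. 253 as typed): `Ū(c) = corr(U,c) · U(c)` and `U(c) = pre · U(β(c)) · post` with `pre`, `post` the two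
half-line transporters and `β(c)` the CENTRAL CROSSING BOND of the axis of `c` — private to `c` and injective in `c`.  So left-multiplying EACH central
coordinate `U(β(c))` by the conjugated correction `pre⁻¹ · corr(U,c) · pre` (a map `Ψ` of the fine configuration space to itself touching only the central
crossing bonds) turns the axial averaging into the typed one: `axial(Ψ U) = Ū(U)` for EVERY `U` (the half-lines meet no central bond).  Consequently
`Ū_*(dU) = axial_*(Ψ_*(dU))` and, `axial` being exactly Haar compatible, THE TYPED E6′ LETTER FOLLOWS FROM `Ψ_*(dU) = dU`; and `Ψ` is TRIANGULAR in the
private coordinates (`(Ψ U)(β(c′))` does not see `U(β(c))`, `c ≠ c′`), so `Ψ_*(dU) = dU` is a statement about the ONE-VARIABLE laws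
`g ↦ pre⁻¹ · corr(U[β(c) ↦ g], c) · pre · g` on `G` — the «fibre laws» the HaarAC modules (`BlockAveragingHaarAC` §4, `BlockAveragingEMLFibreLawSUN`) study for
absolute continuity.  Whether those laws are Haar (they are conjugated PROJECTED means on the guard) is NOT decided here.

WHAT THIS FILE PROVES ([folklore] over landed modules; nothing of Bałaban's asserted; `Ψ` is written INLINE as
`fun b => Function.extend centralBond (fun c => (pre U c)⁻¹ * corr ℰ U c * pre U c) (fun _ => 1) b * U b`, no new object).  §1 the half-lines of `c` meet no
central crossing bond (`ne_centralBond_of_mem_walk_pre ∕ _post`), so `pre`, `post` are blind to any reparametrisation of the central bonds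
(`pre_mulLeft_extend`, `post_mulLeft_extend`).  §2 ★★ `axialAvg_reparam` (`axial (Ψ U) = Ū U`, every `U`, standing range), `reparam_eq_self_of_forall_not_small`
(`Ψ U = U` off the guard), `reparam_update_centralBond_of_ne` (triangularity).  §3 `measurable_reparam`, ★ `map_avgFun_eq_map_map_reparam`
(`Ū_*(dU) = axial_*(Ψ_*(dU))`), ★★ `map_avgFun_eq_of_map_reparam_eq` (`Ψ_*(dU) = dU ⇒ Ū_*(dU) = dV`).  §4 at the [B10] slot `avOfPrint N S j` on `SU(N)`:
`map_avOfPrint_eq_of_map_reparam_eq`, and the T-letter `(𝔗 S j).T 1 =ᵐ 1` for EVERY transformation family under the same hypothesis.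

HONEST FRAMING.  A normal form and a SUFFICIENT condition for the typed E6′ letter; neither E6′ nor `Ψ_*(dU) = dU` is decided (part 6's `measure_guard_pos`
stands); count-neutral; N08 NOT discharged; counts unmoved (typed 28∕28 · discharged 5∕27); one finite 𝕋⁴ programme at fixed ε — R4 closes the CONDITIONAL rung
`BalabanLadder.UV` only; the Yang–Mills mass gap (Clay) is NOT proved by any of this; nothing continuum ∕ ℝ³ ∕ ℝ⁴ ∕ OS ∕ mass gap.  0 `sorry`, 0 `def`,
0 `instance`, standard axioms.
-/

noncomputable section

open MeasureTheory

namespace Summit.QuantumFields.YangMills.BalabanUVNodes.N08HaarCompatibilityGuardReparam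

open Literature.MathematicalPhysics.QuantumFieldTheory.Balaban1983to89
open Literature.MathematicalPhysics.QuantumFieldTheory.Balaban1983to89.T4Continuum
open Literature.MathematicalPhysics.QuantumFieldTheory.Balaban1983to89.T4ReflectionCone (holAt_congr)
open Literature.MathematicalPhysics.QuantumFieldTheory.Balaban1983to89.AveragingRT
  (axialAvg lineSite map_axialAvg measurable_axialAvg two_mul_half_add_one)
open Literature.MathematicalPhysics.QuantumFieldTheory.Balaban1983to89.BlockAveraging
  (Idx loopHol Small corr avgFun measurableSet_small measurable_avgFun measurable_loopHol measurable_corr)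
open Literature.MathematicalPhysics.QuantumFieldTheory.Balaban1983to89.BlockAveragingHaarAC
  (centralBond centralBond_injective pre post axialAvg_eq_pre_mul_mul_post mem_walk_replicate eq_of_mem_walk_line_of_eq_centralBond
    lineSite_apply_int L_dvd_of_emb_add_eq eq_zero_of_L_dvd loopHol_update_centralBond pre_update avgFun_of_not_small)
open Summit.QuantumFields.YangMills.BalabanUVNodes.N08HaarCompatibilityGuard (avgFun_eq_axialAvg_of_not_mem_guard)

/-! ## §1. The half-lines of a coarse bond meet no central crossing bond -/

section HalfLines

variable {P : Params} {j : ℕ}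

/-- The straight line of `c` splits as first half-line, central bond, second half-line: `L = (L−1)∕2 + 1 + (L−1)∕2` letters. [folklore] -/
theorem replicate_line_split (μ : Fin P.d) :
    List.replicate P.L ((μ, true) : Letter P.d) =
      List.replicate ((P.L - 1) / 2) (μ, true) ++ (List.replicate 1 (μ, true) ++ List.replicate ((P.L - 1) / 2) (μ, true)) := by
  rw [← List.replicate_add, ← List.replicate_add]
  congr 1
  have := two_mul_half_add_one P
  omega

/-- **THE FIRST HALF-LINE OF `c` MEETS NO CENTRAL CROSSING BOND**: not `β(c′)`, `c′ ≠ c` (only the line of `c′` contains `β(c′)`), and not `β(c)` (longitudinal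
offsets `< (L−1)∕2`; standing range). [folklore] -/
theorem ne_centralBond_of_mem_walk_pre (hj : j + 1 ≤ P.m + P.K) (c c' : PBond P (j + 1)) {s : LStep P j}
    (hs : s ∈ walk (emb c.src) (List.replicate ((P.L - 1) / 2) (c.dir, true))) : s.bond ≠ centralBond c' := by
  intro h
  have hline : s ∈ walk (emb c.src) (List.replicate P.L (c.dir, true)) := by
    rw [replicate_line_split (P := P) c.dir, walk_append]
    exact List.mem_append_left _ hs
  have hc := eq_of_mem_walk_line_of_eq_centralBond hj c c' hline h
  subst hc
  obtain ⟨-, -, t', ht', hsrc⟩ := mem_walk_replicate hs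
  have h1 := hsrc c'.dir
  rw [h, if_pos rfl] at h1
  change lineSite c' _ c'.dir = _ at h1
  rw [lineSite_apply_int, if_pos rfl] at h1
  have hL := two_mul_half_add_one P
  have h0 := eq_zero_of_L_dvd (L_dvd_of_emb_add_eq hj h1) (by omega) (by omega)
  omega

/-- **THE SECOND HALF-LINE OF `c` MEETS NO CENTRAL CROSSING BOND** (longitudinal offsets `> (L−1)∕2`; standing range). [folklore] -/
theorem ne_centralBond_of_mem_walk_post (hj : j + 1 ≤ P.m + P.K) (c c' : PBond P (j + 1)) {s : LStep P j}
    (hs : s ∈ walk (lineSite c ((P.L - 1) / 2 + 1)) (List.replicate ((P.L - 1) / 2) (c.dir, true))) : s.bond ≠ centralBond c' := by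
  intro h
  have hbase : walkEnd (walkEnd (emb c.src) (List.replicate ((P.L - 1) / 2) (c.dir, true))) (List.replicate 1 ((c.dir, true) : Letter P.d)) =
      lineSite c ((P.L - 1) / 2 + 1) := by
    rw [walkEnd_replicate_line, AveragingRT.lineSite_succ]
    rfl
  have hline : s ∈ walk (emb c.src) (List.replicate P.L (c.dir, true)) := by
    rw [replicate_line_split (P := P) c.dir, walk_append, walk_append, hbase]
    exact List.mem_append_right _ (List.mem_append_right _ hs)
  have hc := eq_of_mem_walk_line_of_eq_centralBond hj c c' hline h
  subst hc
  obtain ⟨-, -, t', ht', hsrc⟩ := mem_walk_replicate hs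
  have h1 := hsrc c'.dir
  rw [h, if_pos rfl, lineSite_apply_int, if_pos rfl] at h1
  change lineSite c' _ c'.dir = _ at h1
  rw [lineSite_apply_int, if_pos rfl, add_assoc, ← Int.cast_add] at h1
  have hL := two_mul_half_add_one P
  have h0 := eq_zero_of_L_dvd (L_dvd_of_emb_add_eq hj h1) (by push_cast; omega) (by push_cast; omega)
  push_cast at h0
  omega

variable {G : Type*} [GaugeGroup G]

/-- **`pre` IS BLIND TO ANY LEFT REPARAMETRISATION OF THE CENTRAL CROSSING BONDS** (standing range). [folklore] -/
theorem pre_mulLeft_extend (hj : j + 1 ≤ P.m + P.K) (m : PBond P (j + 1) → G) (U : GaugeField P j G) (c : PBond P (j + 1)) :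
    pre (fun b => Function.extend centralBond m (fun _ => 1) b * U b) c = pre U c := by
  refine holAt_congr fun s hs => ?_
  show Function.extend centralBond m (fun _ => 1) s.bond * U s.bond = U s.bond
  rw [Function.extend_apply' _ _ _ fun ⟨c', hc'⟩ => ne_centralBond_of_mem_walk_pre hj c c' hs hc'.symm, one_mul]

/-- **`post` IS BLIND TO ANY LEFT REPARAMETRISATION OF THE CENTRAL CROSSING BONDS** (standing range). [folklore] -/
theorem post_mulLeft_extend (hj : j + 1 ≤ P.m + P.K) (m : PBond P (j + 1) → G) (U : GaugeField P j G) (c : PBond P (j + 1)) :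
    post (fun b => Function.extend centralBond m (fun _ => 1) b * U b) c = post U c := by
  refine holAt_congr fun s hs => ?_
  show Function.extend centralBond m (fun _ => 1) s.bond * U s.bond = U s.bond
  rw [Function.extend_apply' _ _ _ fun ⟨c', hc'⟩ => ne_centralBond_of_mem_walk_post hj c c' hs hc'.symm, one_mul]

/-- At the central bond of `c` the multiplier is `m c` (`β` injective in the standing range). [folklore] -/
theorem extend_centralBond_apply (hj : j + 1 ≤ P.m + P.K) (m : PBond P (j + 1) → G) (c : PBond P (j + 1)) :
    Function.extend centralBond m (fun _ => (1 : G)) (centralBond c) = m c :=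
  (centralBond_injective hj).extend_apply m (fun _ => (1 : G)) c

/-- Off the central bonds the multiplier is `1` (the reparametrisation is the identity there). [folklore] -/
theorem extend_centralBond_apply_of_forall_ne (m : PBond P (j + 1) → G) {b : PBond P j} (hb : ∀ c, b ≠ centralBond c) :
    Function.extend centralBond m (fun _ => (1 : G)) b = 1 :=
  Function.extend_apply' _ _ _ fun ⟨c, hc⟩ => hb c hc.symm

end HalfLines

/-! ## §2. The central reparametrisation `Ψ` and the normal form `Ū = axial ∘ Ψ` -/

section Reparam

variable {P : Params} {j : ℕ} {G : Type*} [GaugeGroup G] (ℰ : LoopAverage G)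

/-- **THE NORMAL FORM `axial (Ψ U) = Ū U`**, where `Ψ U` left-multiplies each central coordinate `U(β(c))` by the conjugated correction
`pre⁻¹ · corr(U,c) · pre` and fixes every other bond: the typed (0.4) averaging IS the axial averaging of the reparametrised configuration, for EVERY `U`
(standing range; `axial(Ψ U)(c) = pre · (pre⁻¹ corr pre · U(β(c))) · post = corr · U(c)`). [cite: Balaban1987RG1, (0.4) p.253 (the typed total extension; bookkeeping)] -/
theorem axialAvg_reparam (hj : j + 1 ≤ P.m + P.K) (U : GaugeField P j G) :
    axialAvg (fun b => Function.extend centralBond (fun c => (pre U c)⁻¹ * corr ℰ U c * pre U c) (fun _ => (1 : G)) b * U b) = avgFun ℰ U := by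
  funext c
  rw [axialAvg_eq_pre_mul_mul_post, pre_mulLeft_extend hj, post_mulLeft_extend hj, extend_centralBond_apply hj]
  show pre U c * ((pre U c)⁻¹ * corr ℰ U c * pre U c * U (centralBond c)) * post U c = corr ℰ U c * axialAvg U c
  rw [axialAvg_eq_pre_mul_mul_post]
  group

/-- As maps: `axialAvg ∘ Ψ = avgFun ℰ`. [cite: Balaban1987RG1, (0.4) p.253 (bookkeeping)] -/
theorem axialAvg_comp_reparam (hj : j + 1 ≤ P.m + P.K) :
    (axialAvg : GaugeField P j G → GaugeField P (j + 1) G) ∘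
        (fun (U : GaugeField P j G) (b : PBond P j) => Function.extend centralBond (fun c => (pre U c)⁻¹ * corr ℰ U c * pre U c) (fun _ => (1 : G)) b * U b) =
      avgFun ℰ :=
  funext fun U => axialAvg_reparam ℰ hj U

/-- **OFF THE GUARD `Ψ` IS THE IDENTITY**: if no coarse bond is in its small-field domain every correction is `1`. [cite: Balaban1987RG1, (0.4) p.253 (bookkeeping)] -/
theorem reparam_eq_self_of_forall_not_small (U : GaugeField P j G) (hU : ∀ c, ¬ Small ℰ U c) :
    (fun b => Function.extend centralBond (fun c => (pre U c)⁻¹ * corr ℰ U c * pre U c) (fun _ => (1 : G)) b * U b) = U := by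
  classical
  funext b
  have hm : (fun c => (pre U c)⁻¹ * corr ℰ U c * pre U c) = fun _ => (1 : G) := by
    funext c
    unfold corr
    rw [if_neg (hU c), mul_one, inv_mul_cancel]
  rw [hm]
  show Function.extend centralBond (fun _ => (1 : G)) (fun _ => 1) b * U b = U b
  rw [Function.extend_def]
  split_ifs <;> exact one_mul _

/-- **`Ψ` IS TRIANGULAR IN THE PRIVATE COORDINATES**: its `β(c′)`-output does not see the input `U(β(c))`, `c ≠ c′` (the loops and the half-line of `c′`
avoid `β(c)`) — so `Ψ_*(dU) = dU` is a statement about the ONE-VARIABLE laws `g ↦ pre⁻¹ · corr(U[β(c) ↦ g], c) · pre · g`, the fibre laws of the HaarAC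
modules. [cite: Balaban1987RG1, (0.4) p.253 (bookkeeping)] -/
theorem reparam_update_centralBond_of_ne [DecidableEq (PBond P j)] (hj : j + 1 ≤ P.m + P.K) (U : GaugeField P j G) (c c' : PBond P (j + 1))
    (hc : c' ≠ c) (g : G) :
    (fun b => Function.extend centralBond (fun c'' => (pre (Function.update U (centralBond c) g) c'')⁻¹ *
        corr ℰ (Function.update U (centralBond c) g) c'' * pre (Function.update U (centralBond c) g) c'') (fun _ => (1 : G)) b *
          Function.update U (centralBond c) g b) (centralBond c') =
      (fun b => Function.extend centralBond (fun c'' => (pre U c'')⁻¹ * corr ℰ U c'' * pre U c'') (fun _ => (1 : G)) b * U b) (centralBond c') := by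
  show _ * _ = _ * _
  rw [extend_centralBond_apply hj, extend_centralBond_apply hj, Function.update_of_ne ((centralBond_injective hj).ne hc)]
  have hpre : pre (Function.update U (centralBond c) g) c' = pre U c' := by
    refine holAt_congr fun s hs => Function.update_of_ne ?_ _ _
    exact ne_centralBond_of_mem_walk_pre hj c' c hs
  have hcorr : corr ℰ (Function.update U (centralBond c) g) c' = corr ℰ U c' := by
    unfold corr BlockAveraging.Small
    rw [loopHol_update_centralBond hj U c c' hc g]
  rw [hpre, hcorr]

end Reparam

/-! ## §3. The typed E6′ letter follows from `Ψ_*(dU) = dU` -/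

section Law

variable {P : Params} {j : ℕ} {G : Type*} [GaugeGroup G] [MeasurableSpace G] [RegularGaugeGroup G] (ℰ : LoopAverage G)

/-- `Ψ` is measurable when the small-loop average is. [folklore] -/
theorem measurable_reparam (hE : ∀ n, Measurable fun W : Fin (n + 1) → G => ℰ.E W) :
    Measurable (β := GaugeField P j G) fun U b =>
      Function.extend centralBond (fun c => (pre U c)⁻¹ * corr ℰ U c * pre U c) (fun _ => (1 : G)) b * U b := by
  classical
  refine measurable_pi_lambda _ fun b => Measurable.mul ?_ (measurable_pi_apply b)
  simp only [Function.extend_def]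
  split_ifs with h
  · exact ((T4Continuum.measurable_holAt _).inv.mul (measurable_corr ℰ hE _)).mul (T4Continuum.measurable_holAt _)
  · exact measurable_const

variable [HaarData G]

/-- **`Ū_*(dU) = axial_*(Ψ_*(dU))`**: the image law of the typed averaging is the axial image of the reparametrised law. [cite: Balaban1987RG1, (0.4) p.253 (bookkeeping)] -/
theorem map_avgFun_eq_map_map_reparam (hj : j + 1 ≤ P.m + P.K) (hE : ∀ n, Measurable fun W : Fin (n + 1) → G => ℰ.E W) :
    (fieldMeasure P j G).map (avgFun ℰ) =
      ((fieldMeasure P j G).map (β := GaugeField P j G) fun U b =>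
          Function.extend centralBond (fun c => (pre U c)⁻¹ * corr ℰ U c * pre U c) (fun _ => (1 : G)) b * U b).map axialAvg := by
  rw [Measure.map_map measurable_axialAvg (measurable_reparam ℰ hE), axialAvg_comp_reparam ℰ hj]

/-- **THE TYPED E6′ LETTER FOLLOWS FROM THE `dU`-INVARIANCE OF THE CENTRAL REPARAMETRISATION**: `Ψ_*(dU) = dU ⇒ Ū_*(dU) = dV` (`axial_*(dU) = dV`,
`AveragingRT.map_axialAvg`). [cite: Balaban1987RG1, (0.4) p.253 (bookkeeping; E6′ itself NOT IN PRINT, not decided here)] -/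
theorem map_avgFun_eq_of_map_reparam_eq (hj : j + 1 ≤ P.m + P.K) (hE : ∀ n, Measurable fun W : Fin (n + 1) → G => ℰ.E W)
    (hΨ : (fieldMeasure P j G).map (β := GaugeField P j G) (fun U b =>
        Function.extend centralBond (fun c => (pre U c)⁻¹ * corr ℰ U c * pre U c) (fun _ => (1 : G)) b * U b) = fieldMeasure P j G) :
    (fieldMeasure P j G).map (avgFun ℰ) = fieldMeasure P (j + 1) G := by
  rw [map_avgFun_eq_map_map_reparam ℰ hj hE, hΨ, map_axialAvg hj]

omit [MeasurableSpace G] [RegularGaugeGroup G] [HaarData G] in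
/-- Off the guard EVENT `Ψ` is the identity (so only `dU` restricted to the guard matters for `Ψ_*(dU) = dU`; cf. part 6's localisation).
[cite: Balaban1987RG1, (0.4) p.253 (bookkeeping)] -/
theorem reparam_eq_self_of_not_mem_guard {U : GaugeField P j G} (hU : U ∉ {U : GaugeField P j G | ∃ c : PBond P (j + 1), Small ℰ U c}) :
    (fun b => Function.extend centralBond (fun c => (pre U c)⁻¹ * corr ℰ U c * pre U c) (fun _ => (1 : G)) b * U b) = U :=
  reparam_eq_self_of_forall_not_small ℰ U fun c hc => hU ⟨c, hc⟩

end Law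

/-! ## §4. At the [B10] slot's averaging `avOfPrint N S j` on `SU(N)` -/

section Slot

open Literature.MathematicalPhysics.QuantumFieldTheory.Balaban1985CMP102.Setting (Scales)
open Literature.MathematicalPhysics.QuantumFieldTheory.Balaban1983to89.B10RunsOfRecord (avOfPrint)
open Literature.MathematicalPhysics.QuantumFieldTheory.Balaban1983to89.B10Eq2HaarCompatibility (map_avOfPrint_eq_iff)
open Literature.MathematicalPhysics.QuantumFieldTheory.Balaban1983to89.ExpMeanLog (expMeanLogSU measurable_expMeanLogSU_E)
open Literature.MathematicalPhysics.QuantumFieldTheory.Balaban1983to89.Node00 (SU TFamily₃)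
open Summit.QuantumFields.YangMills.BalabanUVNodes.N08HaarCompatibilityGuard (avOfPrint_avg_of_le)

variable (N : ℕ) [NeZero N] {L : ℕ}

/-- **AT THE SLOT: `(avOfPrint N S j).avg = axial ∘ Ψ`** with the printed exp-mean-log's corrections (standing range, every `N`).
[cite: Balaban1987RG1, (0.4) p.253; Balaban1985UV3, (2) p.256 (bookkeeping)] -/
theorem avOfPrint_avg_eq_axialAvg_comp_reparam (S : Scales L) {j : ℕ} (hj : j + 1 ≤ S.P.m + S.P.K) :
    (avOfPrint N S j).avg = (axialAvg : GaugeField S.P j (SU N) → GaugeField S.P (j + 1) (SU N)) ∘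
        fun (U : GaugeField S.P j (SU N)) (b : PBond S.P j) => Function.extend centralBond
          (fun c => (pre U c)⁻¹ * corr (expMeanLogSU : LoopAverage (SU N)) U c * pre U c) (fun _ => (1 : SU N)) b * U b := by
  rw [avOfPrint_avg_of_le N S hj, axialAvg_comp_reparam _ hj]

/-- **E6′ AT THE SLOT FOLLOWS FROM `Ψ_*(dU) = dU`** (standing range, every `N`; beyond the range E6′ holds outright, p434996).
[cite: Balaban1987RG1, (0.4) p.253; Balaban1985UV3, (2) p.256 (bookkeeping; E6′ NOT IN PRINT, not decided here)] -/
theorem map_avOfPrint_eq_of_map_reparam_eq (S : Scales L) {j : ℕ} (hj : j + 1 ≤ S.P.m + S.P.K)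
    (hΨ : (fieldMeasure S.P j (SU N)).map (β := GaugeField S.P j (SU N)) (fun U b => Function.extend centralBond
        (fun c => (pre U c)⁻¹ * corr (expMeanLogSU : LoopAverage (SU N)) U c * pre U c) (fun _ => (1 : SU N)) b * U b) =
      fieldMeasure S.P j (SU N)) :
    (fieldMeasure S.P j (SU N)).map (avOfPrint N S j).avg = fieldMeasure S.P (j + 1) (SU N) := by
  rw [avOfPrint_avg_of_le N S hj]
  exact map_avgFun_eq_of_map_reparam_eq _ hj measurable_expMeanLogSU_E hΨ

variable (L) in
/-- … in the T-letters: for EVERY transformation family `𝔗 : Node00.TFamily₃ N L`, `Ψ_*(dU) = dU ⇒ (𝔗 S j).T 1 =ᵐ 1` (p434996 `map_avOfPrint_eq_iff`).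
[cite: Balaban1985Averaging, (10) p.19; Balaban1987RG1, (0.4) p.253 (bookkeeping; «T1 = 1» NOT IN PRINT)] -/
theorem TFamily_one_ae_eq_one_of_map_reparam_eq (𝔗 : TFamily₃ N L) (S : Scales L) {j : ℕ} (hj : j + 1 ≤ S.P.m + S.P.K)
    (hΨ : (fieldMeasure S.P j (SU N)).map (β := GaugeField S.P j (SU N)) (fun U b => Function.extend centralBond
        (fun c => (pre U c)⁻¹ * corr (expMeanLogSU : LoopAverage (SU N)) U c * pre U c) (fun _ => (1 : SU N)) b * U b) =
      fieldMeasure S.P j (SU N)) :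
    (𝔗 S j).T 1 =ᵐ[fieldMeasure S.P (j + 1) (SU N)] 1 :=
  (map_avOfPrint_eq_iff N S j 𝔗).1 (map_avOfPrint_eq_of_map_reparam_eq N S hj hΨ)

end Slot

end Summit.QuantumFields.YangMills.BalabanUVNodes.N08HaarCompatibilityGuardReparam

end
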